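import Literature.MathematicalPhysics.QuantumFieldTheory.Balaban1983to89.B7ConclConcrete

/-!
# NODE 00 (YM-PLAN Track A) — NON-VACUITY OF THE STAGE-2 GROUP OF RECORD, HYPOTHESIS HALF: at the r04 carriers of
# [Balaban1985Averaging] (`B7ConclConcrete.concl_concrete`) EVERY antecedent of Props. 1–10 AS TYPED is met — by the unit
# configuration `U₀ ≡ 1`, the zero field `A ≡ 0` and the identity gauge transformation `u ≡ 1` — at EVERY threshold

NODE 00 CELL FILE (seat `pub-ymgap-node00-def`, g5, 2026-08-24; report NODE00-SCOPING.md §3 F3 ∕ §5 Q-N00-6 «VACUITY STANDARD»; companion of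
`Node00NonVacuity.lean` (g4), which does the INDEX half: the five index types `Idx D`, `ℕ`, `KIdx D`, `GIdx 𝔸 D L`, `PUnit` are inhabited).
Tree-only import; single-file checkable; theorems only; count-neutral; NOT proposed (R296).  Kernel bookkeeping over the lineage's carrier
DEFINITIONS (`concreteOneStepBD`, `concreteKStep`, `concreteKExp`, `concreteGaugeData`, `concreteGaugeOneStep`); nothing of Bałaban's asserted.

WHY.  `B7.Concl` = Props. 1–10 AS TYPED (`B7.Prop1Printed` … `Prop10Printed`), each of the shape «∃ constants, ∀ index i, ∀ thresholds α… ≤ c,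
∀ data, ANTECEDENTS(data, α…) → CONCLUSION»; the antecedents are the small-field hypotheses (44) ∕ (52) `plaqDev(Eta) U₀ < α₀`, the field bounds
(109) `|A| < α₁`, the gauge classes (166)–(167) `u ∈ Λ_k(U₀, α₃)`, (176)–(177) and (180).  A conjunct whose antecedents NO datum meets would be
discharged vacuously at the carriers of record.  This file records that at the r04 carriers the unit data meet ALL of them, at every index
(§2–§4: `plaqDev 1 = 0`, `|0| = 0`, `1 ∈ Λ_k(U₀, α₃)` for every background — the lineage's `B7Eq167Flat.inLambda_one` —, (176)–(177) and (180) at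
`u ≡ 1` with deviation `0`), with ONE located exception recorded as such (§4 `gaugeData_plaqDevEta_lt_iff`): in the gauge-transformation family
the background `U₀` is INDEX data (`GIdx.U₀`, (52) at `α₀ = c₂`), its only configuration is `U₀` itself, so Prop. 10's antecedent
`plaqDevEta U₀ < α₀` holds at index `i` iff `α₀ > L^{2k}·sup_p|U₀(∂p) − 1|` — at the unit-background indices (every order `k`) for EVERY `α₀ > 0`
(`gaugeData_antecedents_met`), at a curved background only above its own deviation (print quantifies (52) over `U₀` with `α₀ ≤ c₆`; the
family reading is r04's, located in `B7ConclGauge`'s module docstring).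
HONEST FRAMING: satisfiable antecedents are the second sanity layer of the vacuity standard after inhabited indices; that every FIELD read by a
conjunct is the printed object is the per-field cross-read (report App. G, `B7-PREREAD-AppG.md`).  One finite T⁴ programme, NOT continuum ∕
infinite volume ∕ OS ∕ mass gap ∕ Clay.
-/

noncomputable section

namespace Literature.MathematicalPhysics.QuantumFieldTheory.Balaban1983to89.Node00

open B7Prop2Explicit (pdev unitaryUnits concreteKStep)
open B7ConclOneStep (Idx BddFld concreteOneStepBD)
open B7ConclKExp (KIdx supNorm grpDefect grpDefect_of_mem concreteKExp)
open B7ConclGauge (GIdx BddUnits cB cB_pos concreteGaugeData concreteGaugeOneStep)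
open B7Eq92Concrete (Rc Rc_apply)
open B7Eq99Concrete (R0fun R0fun_one_left)
open B7Eq167Flat (InLambda inLambda_one)
open B7Prop9Flat (SiteBd)
open B7Prop9General (CovBondBd)

variable (𝔸 : Type) [CStarAlgebra 𝔸] (d L : ℕ)

-- `[Nontrivial 𝔸]` (⇒ `‖1‖ = 1`) is taken only by the statements over the `U1`-valued configuration types and `BddUnits`.

/-! ## §1. The unit data: `|0| = 0`, `1` bounded (the fact `sup_p|1(∂p) − 1| = 0` — every transport of `1` is `1`, `B8Ineq130.hol_one` — is
inlined as `simp [pdev, B8Ineq130.hol_one]` where used: as a top-level declaration it would duplicate the Summits-side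
`T4Continuum.ShellMeasureLandauCorrectionB7Flat.pdev_one`, which a Literature module cannot import) -/

/-- The zero bond field is bounded (so it is a term of the lineage's field type `BddFld`). [cite: Balaban1985Averaging, (109) p.34 — bookkeeping] -/
theorem bddAbove_zero_fld : BddAbove (Set.range fun b : B7Prop1Explicit.Site d × Fin d => ‖(0 : B7Prop1Explicit.Site d → Fin d → 𝔸) b.1 b.2‖) :=
  ⟨0, by rintro _ ⟨b, rfl⟩; simp⟩

/-- The zero field has sup norm `|0| = 0`. [cite: Balaban1985Averaging, (109) p.34, (19) p.21 — bookkeeping] -/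
theorem supNorm_zero : supNorm (⟨0, bddAbove_zero_fld 𝔸 d⟩ : BddFld d 𝔸) = 0 := by
  simp [supNorm]

/-! ## §2. Props. 1 and 3 (one-step family `concreteOneStepBD`) and Prop. 2 (`k`-fold family `concreteKStep`) -/

/-- **Props. 1 ∕ 3 — antecedents met at every index, every threshold**: for every plaquette–bond index `i` and all `α₀, α₁ > 0` the unit
configuration and the zero field satisfy (44) `sup|V(∂p) − 1| < α₀` and (109) `|A| < α₁` in the one-step family of record.
[cite: Balaban1985Averaging, Prop. 1 (44)/(51) pp.24–26, Prop. 3 (109)/(122)–(123) pp.34–36 — bookkeeping over the r04 carriers] -/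
theorem oneStep_antecedents_met [Nontrivial 𝔸] (i : Idx d) {α₀ α₁ : ℝ} (hα₀ : 0 < α₀) (hα₁ : 0 < α₁) :
    ∃ (V : (concreteOneStepBD 𝔸 (d := d) L i).Cfg) (A : (concreteOneStepBD 𝔸 (d := d) L i).Fld),
      (concreteOneStepBD 𝔸 (d := d) L i).plaqDev V < α₀ ∧ (concreteOneStepBD 𝔸 (d := d) L i).fldNorm A < α₁ := by
  refine ⟨⟨1, fun _ _ => Subgroup.one_mem _⟩, ⟨0, bddAbove_zero_fld 𝔸 d⟩, ?_, ?_⟩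
  · show pdev (1 : B7Prop1Explicit.Site d → Fin d → 𝔸ˣ) < α₀
    rw [show pdev (1 : B7Prop1Explicit.Site d → Fin d → 𝔸ˣ) = 0 by simp [pdev, B8Ineq130.hol_one]]; exact hα₀
  · show (⨆ b : B7Prop1Explicit.Site d × Fin d, ‖(0 : B7Prop1Explicit.Site d → Fin d → 𝔸) b.1 b.2‖) < α₁
    simpa using hα₁

/-- **Prop. 2 — antecedent met at every index, every threshold**: for every order `k` and every `α₀ > 0` the unit configuration satisfies (52)
`η⁻²·sup|U(∂p) − 1| < α₀` in the `k`-fold family of record (`U(𝔸)`-valued configurations). [cite: Balaban1985Averaging, Prop. 2 (52)/(54) p.26 — bookkeeping over the r04 carriers] -/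
theorem kStep_antecedents_met (k : ℕ) {α₀ : ℝ} (hα₀ : 0 < α₀) :
    ∃ U : (concreteKStep d 𝔸 (unitaryUnits 𝔸) L k).Cfg, (concreteKStep d 𝔸 (unitaryUnits 𝔸) L k).plaqDevEta U < α₀ := by
  refine ⟨⟨1, fun _ _ => Subgroup.one_mem _⟩, ?_⟩
  show pdev (1 : B7Prop1Explicit.Site d → Fin d → 𝔸ˣ) * ((L : ℝ) ^ k) ^ 2 < α₀
  rw [show pdev (1 : B7Prop1Explicit.Site d → Fin d → 𝔸ˣ) = 0 by simp [pdev, B8Ineq130.hol_one], zero_mul]; exact hα₀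

/-! ## §3. Props. 4–7 (`k`-fold expansion family `concreteKExp`) -/

/-- **Props. 4–7 — antecedents met at every index, every threshold**: for every index `i = (k, c, b)` and all `α₀, α₁ > 0` the unit background
(`U(𝔸)`-valued, so the guard `grpDefect = 0`) and the zero fields `A = A′ = 0` satisfy (52) `plaqDevEta U₀ < α₀` and `|A|, |A′| < α₁` in the
`k`-fold expansion family of record. [cite: Balaban1985Averaging, Props. 4–7 (52) p.26, (133)–(135) pp.38–39, (156)–(158) p.42, (164) p.43 — bookkeeping over the r04 carriers] -/
theorem kExp_antecedents_met (i : KIdx d) {α₀ α₁ : ℝ} (hα₀ : 0 < α₀) (hα₁ : 0 < α₁) :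
    ∃ (U₀ : (concreteKExp 𝔸 (unitaryUnits 𝔸) (d := d) L i).Cfg) (A : (concreteKExp 𝔸 (unitaryUnits 𝔸) (d := d) L i).Fld),
      (concreteKExp 𝔸 (unitaryUnits 𝔸) (d := d) L i).plaqDevEta U₀ < α₀ ∧
        (concreteKExp 𝔸 (unitaryUnits 𝔸) (d := d) L i).fldNorm A < α₁ := by
  refine ⟨(1 : B7Prop1Explicit.Site d → Fin d → 𝔸ˣ), ⟨0, bddAbove_zero_fld 𝔸 d⟩, ?_, ?_⟩
  · show pdev (1 : B7Prop1Explicit.Site d → Fin d → 𝔸ˣ) * ((L : ℝ) ^ i.k) ^ 2 + grpDefect (unitaryUnits 𝔸) (1 : B7Prop1Explicit.Site d → Fin d → 𝔸ˣ) < α₀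
    rw [show pdev (1 : B7Prop1Explicit.Site d → Fin d → 𝔸ˣ) = 0 by simp [pdev, B8Ineq130.hol_one], zero_mul, zero_add,
      grpDefect_of_mem (U := (1 : B7Prop1Explicit.Site d → Fin d → 𝔸ˣ)) fun _ _ => Subgroup.one_mem _]; exact hα₀
  · show supNorm (⟨0, bddAbove_zero_fld 𝔸 d⟩ : BddFld d 𝔸) < α₁
    rw [supNorm_zero]; exact hα₁

/-! ## §4. Props. 8 and 10 (gauge-transformation family `concreteGaugeData`) and Prop. 9 (one-step gauge family `concreteGaugeOneStep`) -/

/-- **Props. 8 ∕ 10, the gauge-transformation side — met at EVERY index (every background `U₀` of the family), all thresholds `α₃, α₄ ≥ 0`**: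
the identity `u ≡ 1` is `U(𝔸)`-valued, lies in `Λ_k(U₀, α₃)` ((166)–(167); the lineage's `B7Eq167Flat.inLambda_one`) and satisfies (176)
`|u − 1| ≤ α₄` and (177) `|u⁻¹(b₋)R_{0,b}u(b₊) − 1| ≤ α₄η` (`R(X)1 = 1`). [cite: Balaban1985Averaging, (166)–(167) p.44, (176)–(177) p.45, Prop. 8 p.45, Prop. 10 p.50 — bookkeeping over the r04 carriers] -/
theorem gaugeData_transformation_antecedents_met (i : GIdx 𝔸 d L) {α₃ α₄ : ℝ} (hα₃ : 0 ≤ α₃) (hα₄ : 0 ≤ α₄)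
    (V : (concreteGaugeData 𝔸 (d := d) L i).Cfg) :
    ∃ u : (concreteGaugeData 𝔸 (d := d) L i).GT,
      (concreteGaugeData 𝔸 (d := d) L i).InLambda V α₃ u ∧ (concreteGaugeData 𝔸 (d := d) L i).Reg176 α₄ u := by
  refine ⟨(1 : B7Prop1Explicit.Site d → 𝔸ˣ), ?_, ?_⟩
  · show (∀ x : B7Prop1Explicit.Site d, (1 : B7Prop1Explicit.Site d → 𝔸ˣ) x ∈ unitaryUnits 𝔸) ∧ InLambda L V.1 (1 : B7Prop1Explicit.Site d → 𝔸ˣ) i.k α₃ (((L : ℝ) ^ i.k)⁻¹)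
    exact ⟨fun _ => Subgroup.one_mem _, inLambda_one L V.1 i.k hα₃ (by positivity)⟩
  · show SiteBd (1 : B7Prop1Explicit.Site d → 𝔸ˣ) α₄ ∧ CovBondBd i.U₀ (1 : B7Prop1Explicit.Site d → 𝔸ˣ) (α₄ * ((L : ℝ) ^ i.k)⁻¹)
    refine ⟨fun x => ?_, fun x κ => ?_⟩
    · simpa using hα₄
    · have h : (0 : ℝ) ≤ α₄ * ((L : ℝ) ^ i.k)⁻¹ := by positivity
      simpa using h

/-- **Prop. 10, the background side — LOCATED READING**: in the gauge-transformation family the background is index data and the only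
configuration at index `i` is `U₀ = i.U₀`, so the antecedent (52) `plaqDevEta U₀ < α₀` holds at `i` iff `α₀ > L^{2k}·sup_p|U₀(∂p) − 1|`.
[cite: Balaban1985Averaging, (52) p.26, Prop. 10 p.50 — bookkeeping over the r04 carriers] -/
theorem gaugeData_plaqDevEta_lt_iff (i : GIdx 𝔸 d L) (V : (concreteGaugeData 𝔸 (d := d) L i).Cfg) (α₀ : ℝ) :
    (concreteGaugeData 𝔸 (d := d) L i).plaqDevEta V < α₀ ↔ pdev i.U₀ * ((L : ℝ) ^ i.k) ^ 2 < α₀ := by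
  obtain ⟨V, hV⟩ := V
  subst hV
  exact Iff.rfl

/-- **Props. 8 ∕ 10 — ALL antecedents met, every order `k`, every threshold**: for `L ≥ 1`, every `k` and all `α₀ > 0`, `α₃, α₄ ≥ 0` the
unit-background index `i = (k, U₀ ≡ 1)` (it satisfies (52) at `α₀ = c₂ > 0`, `B7ConclGauge.cB_pos`) carries a configuration with
`plaqDevEta < α₀` and the identity transformations `u′ = u₁ = u₂ ≡ 1` meeting (166)–(167) and (176)–(177). [cite: Balaban1985Averaging, (52) p.26, (166)–(167) p.44, (176)–(177) p.45, Props. 8/10 pp.45–50 — bookkeeping over the r04 carriers] -/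
theorem gaugeData_antecedents_met (hL : 1 ≤ L) (k : ℕ) {α₀ α₃ α₄ : ℝ} (hα₀ : 0 < α₀) (hα₃ : 0 ≤ α₃) (hα₄ : 0 ≤ α₄) :
    ∃ i : GIdx 𝔸 d L, i.k = k ∧
      ∃ (U₀ : (concreteGaugeData 𝔸 (d := d) L i).Cfg) (u : (concreteGaugeData 𝔸 (d := d) L i).GT),
        (concreteGaugeData 𝔸 (d := d) L i).plaqDevEta U₀ < α₀ ∧ (concreteGaugeData 𝔸 (d := d) L i).InLambda U₀ α₃ u ∧
          (concreteGaugeData 𝔸 (d := d) L i).Reg176 α₄ u := by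
  let i : GIdx 𝔸 d L :=
    { k := k, U₀ := 1, hU₀ := fun _ _ => Subgroup.one_mem _,
      h52 := by rw [show pdev (1 : B7Prop1Explicit.Site d → Fin d → 𝔸ˣ) = 0 by simp [pdev, B8Ineq130.hol_one], zero_mul]; exact cB_pos d hL }
  obtain ⟨u, hu, hu'⟩ := gaugeData_transformation_antecedents_met 𝔸 d L i hα₃ hα₄ ⟨1, rfl⟩
  refine ⟨i, rfl, ⟨1, rfl⟩, u, ?_, hu, hu'⟩
  rw [gaugeData_plaqDevEta_lt_iff]
  show pdev (1 : B7Prop1Explicit.Site d → Fin d → 𝔸ˣ) * ((L : ℝ) ^ k) ^ 2 < α₀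
  rw [show pdev (1 : B7Prop1Explicit.Site d → Fin d → 𝔸ˣ) = 0 by simp [pdev, B8Ineq130.hol_one], zero_mul]; exact hα₀

/-- The identity site function is a bounded unit function (bound `M = 1`), so it is a term of the lineage's type `BddUnits`.
[cite: Balaban1985Averaging, (176) p.45 — bookkeeping] -/
theorem bdd_one_units [Nontrivial 𝔸] : ∃ M : ℝ, ∀ y : B7Prop1Explicit.Site d, ‖(((1 : B7Prop1Explicit.Site d → 𝔸ˣ) y : 𝔸ˣ) : 𝔸)‖ ≤ M ∧ ‖((((1 : B7Prop1Explicit.Site d → 𝔸ˣ) y)⁻¹ : 𝔸ˣ) : 𝔸)‖ ≤ M :=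
  ⟨1, fun _ => by simp⟩

/-- **Prop. 9 — ALL FIVE antecedents (180) met, every threshold**: at the single index of the one-step gauge family, for all
`α₀, α₃, α₄, α₄′ > 0` and `Lα₃′ > 0` the unit configuration `V₀ ≡ 1` and the identity transformations `v′ = v₁ ≡ 1` have
`sup|V₀(∂p) − 1| = 0 < α₀`, `sup|v′ − 1| = 0 < α₄`, `sup|v′⁻¹(b₋)R_{0,b}v′(b₊) − 1| = 0 < α₄′`, `sup|v₁ − 1| = 0 < α₃`,
`sup|v₁⁻¹(y)(R₀v₁)(x) − 1| = 0 < Lα₃′`. [cite: Balaban1985Averaging, (180) p.46, Prop. 9 (199)–(200) p.49 — bookkeeping over the r04 carriers] -/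
theorem gaugeOneStep_antecedents_met [Nontrivial 𝔸] (i : PUnit) {α₀ α₃ α₃' α₄ α₄' : ℝ} (hα₀ : 0 < α₀) (hα₃ : 0 < α₃)
    (hα₃' : 0 < (L : ℝ) * α₃') (hα₄ : 0 < α₄) (hα₄' : 0 < α₄') :
    ∃ (V₀ : (concreteGaugeOneStep 𝔸 (d := d) L i).Cfg) (v' v₁ : (concreteGaugeOneStep 𝔸 (d := d) L i).GT),
      (concreteGaugeOneStep 𝔸 (d := d) L i).plaqDev V₀ < α₀ ∧ (concreteGaugeOneStep 𝔸 (d := d) L i).dev v' < α₄ ∧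
        (concreteGaugeOneStep 𝔸 (d := d) L i).covDev V₀ v' < α₄' ∧ (concreteGaugeOneStep 𝔸 (d := d) L i).dev v₁ < α₃ ∧
          (concreteGaugeOneStep 𝔸 (d := d) L i).blockCovDev V₀ v₁ < L * α₃' := by
  refine ⟨⟨1, fun _ _ => Subgroup.one_mem _⟩, ⟨1, bdd_one_units 𝔸 d⟩, ⟨1, bdd_one_units 𝔸 d⟩, ?_, ?_, ?_, ?_, ?_⟩
  · show pdev (1 : B7Prop1Explicit.Site d → Fin d → 𝔸ˣ) < α₀
    rw [show pdev (1 : B7Prop1Explicit.Site d → Fin d → 𝔸ˣ) = 0 by simp [pdev, B8Ineq130.hol_one]]; exact hα₀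
  · show (⨆ y : B7Prop1Explicit.Site d, ‖(((1 : B7Prop1Explicit.Site d → 𝔸ˣ) y : 𝔸ˣ) : 𝔸) - 1‖) < α₄
    simpa using hα₄
  · show (⨆ b : B7Prop1Explicit.Site d × Fin d,
      ‖(((((1 : B7Prop1Explicit.Site d → 𝔸ˣ) b.1)⁻¹ * Rc ((1 : B7Prop1Explicit.Site d → Fin d → 𝔸ˣ) b.1 b.2) ((1 : B7Prop1Explicit.Site d → 𝔸ˣ) (b.1 + B7Prop1Explicit.e b.2)) : 𝔸ˣ)) : 𝔸) - 1‖) < α₄'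
    simpa using hα₄'
  · show (⨆ y : B7Prop1Explicit.Site d, ‖(((1 : B7Prop1Explicit.Site d → 𝔸ˣ) y : 𝔸ˣ) : 𝔸) - 1‖) < α₃
    simpa using hα₃
  · show (⨆ p : B7Prop1Explicit.Site d × (Fin d → Fin L),
      ‖(((((1 : B7Prop1Explicit.Site d → 𝔸ˣ) ((L : ℤ) • p.1))⁻¹ *
          R0fun (1 : B7Prop1Explicit.Site d → Fin d → 𝔸ˣ) ((L : ℤ) • p.1) (1 : B7Prop1Explicit.Site d → 𝔸ˣ) ((L : ℤ) • p.1 + B7Prop1Explicit.boxVec L p.2) : 𝔸ˣ)) : 𝔸) - 1‖) < L * α₃'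
    simpa using hα₃'

/-! ## §5. Summary: at the r04 carriers of `concl_concrete` no conjunct of `B7.Concl` has unsatisfiable antecedents -/

/-- **Summary (the five families of `B7ConclConcrete.concl_concrete`, `L ≥ 1`)**: for every order `k`, all indices of the one-step ∕ k-fold ∕
k-fold-expansion families and all thresholds, data meeting every antecedent of Props. 1–7 exist; the gauge-transformation antecedents of
Props. 8 ∕ 10 are met at every index and the background antecedent at the unit-background index of every order; the five antecedents (180) of
Prop. 9 are met.  (Positivity of the thresholds is what print assumes: «positive constants … α₀ ≤ c».) [cite: Balaban1985Averaging, Props. 1–10 pp.26–50 — bookkeeping over the r04 carriers] -/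
theorem concl_concrete_antecedents_met [Nontrivial 𝔸] (hL : 1 ≤ L) (i₁ : Idx d) (k : ℕ) (i₃ : KIdx d) {α₀ α₁ α₃ α₄ : ℝ}
    (hα₀ : 0 < α₀) (hα₁ : 0 < α₁) (hα₃ : 0 < α₃) (hα₄ : 0 < α₄) :
    (∃ (V : (concreteOneStepBD 𝔸 (d := d) L i₁).Cfg) (A : (concreteOneStepBD 𝔸 (d := d) L i₁).Fld),
        (concreteOneStepBD 𝔸 (d := d) L i₁).plaqDev V < α₀ ∧ (concreteOneStepBD 𝔸 (d := d) L i₁).fldNorm A < α₁) ∧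
      (∃ U : (concreteKStep d 𝔸 (unitaryUnits 𝔸) L k).Cfg, (concreteKStep d 𝔸 (unitaryUnits 𝔸) L k).plaqDevEta U < α₀) ∧
      (∃ (U₀ : (concreteKExp 𝔸 (unitaryUnits 𝔸) (d := d) L i₃).Cfg) (A : (concreteKExp 𝔸 (unitaryUnits 𝔸) (d := d) L i₃).Fld),
        (concreteKExp 𝔸 (unitaryUnits 𝔸) (d := d) L i₃).plaqDevEta U₀ < α₀ ∧
          (concreteKExp 𝔸 (unitaryUnits 𝔸) (d := d) L i₃).fldNorm A < α₁) ∧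
      (∃ i : GIdx 𝔸 d L, i.k = k ∧
        ∃ (U₀ : (concreteGaugeData 𝔸 (d := d) L i).Cfg) (u : (concreteGaugeData 𝔸 (d := d) L i).GT),
          (concreteGaugeData 𝔸 (d := d) L i).plaqDevEta U₀ < α₀ ∧ (concreteGaugeData 𝔸 (d := d) L i).InLambda U₀ α₃ u ∧
            (concreteGaugeData 𝔸 (d := d) L i).Reg176 α₄ u) ∧
      (∃ (V₀ : (concreteGaugeOneStep 𝔸 (d := d) L PUnit.unit).Cfg) (v' v₁ : (concreteGaugeOneStep 𝔸 (d := d) L PUnit.unit).GT),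
        (concreteGaugeOneStep 𝔸 (d := d) L PUnit.unit).plaqDev V₀ < α₀ ∧ (concreteGaugeOneStep 𝔸 (d := d) L PUnit.unit).dev v' < α₄ ∧
          (concreteGaugeOneStep 𝔸 (d := d) L PUnit.unit).covDev V₀ v' < α₄ ∧
            (concreteGaugeOneStep 𝔸 (d := d) L PUnit.unit).dev v₁ < α₃ ∧
              (concreteGaugeOneStep 𝔸 (d := d) L PUnit.unit).blockCovDev V₀ v₁ < L * α₃) :=
  ⟨oneStep_antecedents_met 𝔸 d L i₁ hα₀ hα₁, kStep_antecedents_met 𝔸 d L k hα₀, kExp_antecedents_met 𝔸 d L i₃ hα₀ hα₁,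
    gaugeData_antecedents_met 𝔸 d L hL k hα₀ hα₃.le hα₄.le,
    gaugeOneStep_antecedents_met 𝔸 d L PUnit.unit hα₀ hα₃ (mul_pos (Nat.cast_pos.mpr hL) hα₃) hα₄ hα₄⟩

end Literature.MathematicalPhysics.QuantumFieldTheory.Balaban1983to89.Node00

end
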